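import Summits.BirchSwinnertonDyer.Rank1Residual.GaloisImage.TameThreeTorsionValuationField
import Summits.BirchSwinnertonDyer.Rank1Residual.GaloisImage.TameNineTorsionValuation
import HarnessLib

/-!
# Valuations of the `3`- and `9`-torsion abscissae on a Kodaira-`III*`-shaped equation at `3`,
# by reduction to the `III`-shape (cell `b2b-bsdres`, team n1011, seat p14 gen 2, OWNERS row T-b9
# 'tame tower at 3', steps S1/S2 for `III*`)

HONEST FRAMING (cell `b2b-bsdres`, run/shared/lean/b2b/bsd-rank1-residual/, verbatim in every
file): the goal of the cell is to DELETE the COMBINATION-SHAPED residual classes of the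
Birch–Swinnerton-Dyer formula for ALL analytic-rank `≤ 1` elliptic curves over `ℚ` — "full BSD
formula for every rank `≤ 1` curve in class `C`" assembled STRICTLY from published theorems — so
that the rank-`≤ 1` remainder becomes exactly the CONSTRUCTION-SHAPED classes, which are TYPED
(missing-input `Prop`s), NOT attempted. This is not "finishing BSD". Team n1011 (N10 / N11, the
additive block X4 ∧ `p = 3`): research route on the CONSTRUCTION-SHAPED class X4; no claim beyond the
stated classes; nothing is booked. Theorems only (no definition, no named fact).

## What this file proves

A Weierstrass equation `W` over `ℚ̄` is **`III*`-shaped at the place `v` over `3`** if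
`v(b₂) ≤ v(3)²`, `v(b₄) = v(3)³`, `v(b₆) ≤ v(3)⁵`, `v(b₈) = v(3)⁶` (the shape of a Kodaira-`III*`
equation with its singular point at the origin: `9 ∣ b₂`, `27 ∥ b₄`, `3⁵ ∣ b₆`).  For `u ∈ ℚ̄` with
`u² = 3` the `ℚ̄`-isomorphic equation `W' = ⟨u, 0, 0, 0⟩ • W` has `bᵢ' = bᵢ / uⁱ` and is `III`-SHAPED,
and `ψ₃`, `Φ₃` transform by `ψ₃'(x/3) = ψ₃(x)/3⁴`, `Φ₃'(x/3) = Φ₃(x)/3⁹`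
(`eval_Ψ₃_variableChange_sqrt3`, `mul_rel_variableChange_sqrt3`).  Hence the `III` statements of
`TameThreeTorsionValuationField` / `TameNineTorsionValuation` give, for `III*`:

* `IIIstar.valuation_le_of_isRoot_Ψ₃` — every root of `ψ₃` has `v(ξ) ≤ v(3)`;
* `IIIstar.valuation_pow_four_eq_of_isRoot_Ψ₃` — CASE B′ (`v(b₂) ≤ v(3)³`): `v(ξ)⁴ = v(3)⁵`;
* `IIIstar.valuation_eq_or_pow_three_eq_of_isRoot_Ψ₃` — CASE A′ (`v(b₂) = v(3)²`):
  `v(ξ) = v(3) ∨ v(ξ)³ = v(3)⁴`, and `IIIstar.exists_isRoot_Ψ₃_valuation_pow_three_eq`;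
* `IIIstar.valuation_pow_nine_eq_of_mul_rel` — `x'ψ₃(x)² = Φ₃(x)`, `v(3)⁴ ≤ v(x')³`,
  `v(x') ≤ v(3)` ⟹ **`v(x)⁹ = v(x') v(3)¹²`** (abscissae of order `9`: 13/9, 40/27, 53/36).

These are the patterns of all 4 341 Kodaira-`III*` cells of the X4@3 r0 residue (research note
`HOME/b2b-bsdres-n1011-p14/e4/TAME-TOWER-NOTE.md`).  Steps S1/S2 only; no tower claimed here.
-/

noncomputable section

open scoped Classical

open Polynomial WeierstrassCurve

namespace Summit.BirchSwinnertonDyer.Rank1Residual.GaloisImage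

open Literature.NumberTheory.EllipticCurves

variable (W : WeierstrassCurve (AlgebraicClosure ℚ))

/-! ### §1 The scaling `⟨u, 0, 0, 0⟩ • W`, `u² = 3` -/

section Scaling

variable {u : AlgebraicClosure ℚ} (hu : u ≠ 0)

/-- `b₂` of the rescaled equation: `b₂' = u⁻² b₂`. [folklore] -/
theorem b₂_variableChange_u :
    ((VariableChange.mk (Units.mk0 u hu) 0 0 0) • W).b₂ = u⁻¹ ^ 2 * W.b₂ := by
  rw [variableChange_b₂]; simp

/-- `b₄' = u⁻⁴ b₄`. [folklore] -/
theorem b₄_variableChange_u :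
    ((VariableChange.mk (Units.mk0 u hu) 0 0 0) • W).b₄ = u⁻¹ ^ 4 * W.b₄ := by
  rw [variableChange_b₄]; simp

/-- `b₆' = u⁻⁶ b₆`. [folklore] -/
theorem b₆_variableChange_u :
    ((VariableChange.mk (Units.mk0 u hu) 0 0 0) • W).b₆ = u⁻¹ ^ 6 * W.b₆ := by
  rw [variableChange_b₆]; simp

/-- `b₈' = u⁻⁸ b₈`. [folklore] -/
theorem b₈_variableChange_u :
    ((VariableChange.mk (Units.mk0 u hu) 0 0 0) • W).b₈ = u⁻¹ ^ 8 * W.b₈ := by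
  rw [variableChange_b₈]; simp

/-- `ψ₃` is isobaric of weight `8`: `ψ₃'(u⁻² x) = u⁻⁸ ψ₃(x)`. [folklore] -/
theorem eval_Ψ₃_variableChange_u (x : AlgebraicClosure ℚ) :
    ((VariableChange.mk (Units.mk0 u hu) 0 0 0) • W).Ψ₃.eval (u⁻¹ ^ 2 * x) =
      u⁻¹ ^ 8 * W.Ψ₃.eval x := by
  rw [eval_Ψ₃, eval_Ψ₃, b₂_variableChange_u, b₄_variableChange_u, b₆_variableChange_u,
    b₈_variableChange_u]
  ring

/-- `Φ₃ − x'ψ₃²` is isobaric of weight `18`: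
`Φ₃'(u⁻²x) − (u⁻²x')ψ₃'(u⁻²x)² = u⁻¹⁸ (Φ₃(x) − x'ψ₃(x)²)`. [folklore] -/
theorem eval_Φ_three_sub_variableChange_u (x x' : AlgebraicClosure ℚ) :
    (((VariableChange.mk (Units.mk0 u hu) 0 0 0) • W).Φ 3).eval (u⁻¹ ^ 2 * x) -
        (u⁻¹ ^ 2 * x') * (((VariableChange.mk (Units.mk0 u hu) 0 0 0) • W).Ψ₃.eval (u⁻¹ ^ 2 * x)) ^ 2 =
      u⁻¹ ^ 18 * ((W.Φ 3).eval x - x' * (W.Ψ₃.eval x) ^ 2) := by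
  rw [eval_Φ_three_sub_mul_Ψ₃_sq, eval_Φ_three_sub_mul_Ψ₃_sq, b₂_variableChange_u,
    b₄_variableChange_u, b₆_variableChange_u, b₈_variableChange_u]
  ring

end Scaling

/-! ### §2 Valuation bookkeeping for `u² = 3` -/

section Sqrt3

variable {u : AlgebraicClosure ℚ} (hu0 : u ≠ 0) (hu2 : u ^ 2 = 3)

include hu0 hu2

/-- `v(u⁻²ᵏ) · v(3)ᵏ = 1` for `u² = 3`. [folklore] -/
theorem valuation_inv_u_pow_mul (k : ℕ) :
    (placeOver 3).valuation (u⁻¹ ^ (2 * k)) * (placeOver 3).valuation (3 : AlgebraicClosure ℚ) ^ k =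
      1 := by
  have hvu : (placeOver 3).valuation u ^ 2 = (placeOver 3).valuation (3 : AlgebraicClosure ℚ) := by
    rw [← map_pow, hu2]
  have hvu0 : (placeOver 3).valuation u ≠ 0 := (Valuation.ne_zero_iff _).mpr hu0
  rw [map_pow, map_inv₀, pow_mul, ← hvu, ← mul_pow, ← mul_pow, inv_mul_cancel₀ hvu0, one_pow,
    one_pow]

/-- `v(u⁻²ᵏ b) · v(3)ᵏ = v(b)`. [folklore] -/
theorem valuation_inv_u_pow_mul_eq (k : ℕ) (b : AlgebraicClosure ℚ) :
    (placeOver 3).valuation (u⁻¹ ^ (2 * k) * b) * (placeOver 3).valuation (3 : AlgebraicClosure ℚ) ^ k =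
      (placeOver 3).valuation b := by
  rw [map_mul, mul_right_comm, valuation_inv_u_pow_mul hu0 hu2 k, one_mul]

/-- Transfer of an upper bound: `v(b) ≤ v(3)^{k+m} ⟹ v(u⁻²ᵏ b) ≤ v(3)ᵐ`. [folklore] -/
theorem valuation_inv_u_pow_mul_le {k m : ℕ} {b : AlgebraicClosure ℚ}
    (hb : (placeOver 3).valuation b ≤ (placeOver 3).valuation (3 : AlgebraicClosure ℚ) ^ (k + m)) :
    (placeOver 3).valuation (u⁻¹ ^ (2 * k) * b) ≤ (placeOver 3).valuation (3 : AlgebraicClosure ℚ) ^ m := by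
  set t := (placeOver 3).valuation (3 : AlgebraicClosure ℚ) with ht
  have ht0 : t ≠ 0 := valuation_three_ne_zero
  have h := valuation_inv_u_pow_mul_eq hu0 hu2 k b
  have : (placeOver 3).valuation (u⁻¹ ^ (2 * k) * b) * t ^ k ≤ t ^ m * t ^ k := by
    rw [h, ← pow_add, add_comm]; exact hb
  exact le_of_mul_le_mul_right this (zero_lt_iff.mpr (pow_ne_zero _ ht0))

/-- Transfer of an exact valuation: `v(b) = v(3)^{k+m} ⟹ v(u⁻²ᵏ b) = v(3)ᵐ`. [folklore] -/
theorem valuation_inv_u_pow_mul_eq_pow {k m : ℕ} {b : AlgebraicClosure ℚ}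
    (hb : (placeOver 3).valuation b = (placeOver 3).valuation (3 : AlgebraicClosure ℚ) ^ (k + m)) :
    (placeOver 3).valuation (u⁻¹ ^ (2 * k) * b) = (placeOver 3).valuation (3 : AlgebraicClosure ℚ) ^ m := by
  set t := (placeOver 3).valuation (3 : AlgebraicClosure ℚ) with ht
  have ht0 : t ≠ 0 := valuation_three_ne_zero
  have h := valuation_inv_u_pow_mul_eq hu0 hu2 k b
  have : (placeOver 3).valuation (u⁻¹ ^ (2 * k) * b) * t ^ k = t ^ m * t ^ k := by
    rw [h, ← pow_add, add_comm]; exact hb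
  exact mul_right_cancel₀ (pow_ne_zero _ ht0) this

end Sqrt3

/-! ### §3 The `III*` statements -/

namespace IIIstar

/-- **`III*`: every root of `ψ₃` has `v(ξ) ≤ v(3)`** (`v(b₂) ≤ v(3)²`, `v(b₄) ≤ v(3)³`,
`v(b₆) ≤ v(3)⁵`, `v(b₈) ≤ v(3)⁶`). [folklore] -/
theorem valuation_le_of_isRoot_Ψ₃
    (hb2 : (placeOver 3).valuation W.b₂ ≤ (placeOver 3).valuation (3 : AlgebraicClosure ℚ) ^ 2)
    (hb4 : (placeOver 3).valuation W.b₄ ≤ (placeOver 3).valuation (3 : AlgebraicClosure ℚ) ^ 3)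
    (hb6 : (placeOver 3).valuation W.b₆ ≤ (placeOver 3).valuation (3 : AlgebraicClosure ℚ) ^ 5)
    (hb8 : (placeOver 3).valuation W.b₈ ≤ (placeOver 3).valuation (3 : AlgebraicClosure ℚ) ^ 6)
    {x : AlgebraicClosure ℚ} (hx : W.Ψ₃.IsRoot x) :
    (placeOver 3).valuation x ≤ (placeOver 3).valuation (3 : AlgebraicClosure ℚ) := by
  set v := (placeOver 3).valuation with hv
  set t := v (3 : AlgebraicClosure ℚ) with ht
  obtain ⟨u, hu2⟩ := IsAlgClosed.exists_pow_nat_eq (3 : AlgebraicClosure ℚ) (by norm_num : 0 < 2)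
  have hu0 : u ≠ 0 := by rintro rfl; norm_num at hu2
  set W' := (VariableChange.mk (Units.mk0 u hu0) 0 0 0) • W with hW'
  have hb2' : v W'.b₂ ≤ t := by
    rw [hW', b₂_variableChange_u]
    simpa using valuation_inv_u_pow_mul_le hu0 hu2 (k := 1) (m := 1) (by simpa using hb2)
  have hb4' : v W'.b₄ ≤ t := by
    rw [hW', b₄_variableChange_u]
    simpa using valuation_inv_u_pow_mul_le hu0 hu2 (k := 2) (m := 1) (by simpa using hb4)
  have hb6' : v W'.b₆ ≤ t ^ 2 := by
    rw [hW', b₆_variableChange_u]; exact valuation_inv_u_pow_mul_le hu0 hu2 (k := 3) (m := 2) hb6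
  have hb8' : v W'.b₈ ≤ t ^ 2 := by
    rw [hW', b₈_variableChange_u]; exact valuation_inv_u_pow_mul_le hu0 hu2 (k := 4) (m := 2) hb8
  have hx' : W'.Ψ₃.IsRoot (u⁻¹ ^ 2 * x) := by
    rw [IsRoot.def, hW', eval_Ψ₃_variableChange_u, hx.eq_zero, mul_zero]
  have h := valuation_le_one_of_isRoot_Ψ₃' W' hb2' hb4' hb6' hb8' hx'
  have h1 := valuation_inv_u_pow_mul_eq hu0 hu2 1 x
  rw [pow_one] at h1
  calc v x = v (u⁻¹ ^ (2 * 1) * x) * t := h1.symm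
    _ ≤ 1 * t := mul_le_mul' h le_rfl
    _ = t := one_mul _

/-- **`III*`, CASE B′ (`v(b₂) ≤ v(3)³`): every root of `ψ₃` has `v(ξ)⁴ = v(3)⁵`**
(`v(b₄) = v(3)³`, `v(b₆) ≤ v(3)⁵`, `v(b₈) = v(3)⁶`). [folklore] -/
theorem valuation_pow_four_eq_of_isRoot_Ψ₃
    (hb2 : (placeOver 3).valuation W.b₂ ≤ (placeOver 3).valuation (3 : AlgebraicClosure ℚ) ^ 3)
    (hb4 : (placeOver 3).valuation W.b₄ = (placeOver 3).valuation (3 : AlgebraicClosure ℚ) ^ 3)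
    (hb6 : (placeOver 3).valuation W.b₆ ≤ (placeOver 3).valuation (3 : AlgebraicClosure ℚ) ^ 5)
    (hb8 : (placeOver 3).valuation W.b₈ = (placeOver 3).valuation (3 : AlgebraicClosure ℚ) ^ 6)
    {x : AlgebraicClosure ℚ} (hx : W.Ψ₃.IsRoot x) :
    (placeOver 3).valuation x ^ 4 = (placeOver 3).valuation (3 : AlgebraicClosure ℚ) ^ 5 := by
  set v := (placeOver 3).valuation with hv
  set t := v (3 : AlgebraicClosure ℚ) with ht
  obtain ⟨u, hu2⟩ := IsAlgClosed.exists_pow_nat_eq (3 : AlgebraicClosure ℚ) (by norm_num : 0 < 2)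
  have hu0 : u ≠ 0 := by rintro rfl; norm_num at hu2
  set W' := (VariableChange.mk (Units.mk0 u hu0) 0 0 0) • W with hW'
  have hb2' : v W'.b₂ ≤ t ^ 2 := by
    rw [hW', b₂_variableChange_u]; exact valuation_inv_u_pow_mul_le hu0 hu2 (k := 1) (m := 2) hb2
  have hb4' : v W'.b₄ = t := by
    rw [hW', b₄_variableChange_u]
    simpa using valuation_inv_u_pow_mul_eq_pow hu0 hu2 (k := 2) (m := 1) (by simpa using hb4)
  have hb6' : v W'.b₆ ≤ t ^ 2 := by
    rw [hW', b₆_variableChange_u]; exact valuation_inv_u_pow_mul_le hu0 hu2 (k := 3) (m := 2) hb6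
  have hb8' : v W'.b₈ = t ^ 2 := by
    rw [hW', b₈_variableChange_u]; exact valuation_inv_u_pow_mul_eq_pow hu0 hu2 (k := 4) (m := 2) hb8
  have hx' : W'.Ψ₃.IsRoot (u⁻¹ ^ 2 * x) := by
    rw [IsRoot.def, hW', eval_Ψ₃_variableChange_u, hx.eq_zero, mul_zero]
  have h := valuation_pow_four_eq_of_isRoot_Ψ₃' W' hb2' hb4' hb6' hb8' hx'
  -- `v(u⁻² x)⁴ = t` ⟹ `v(x)⁴ = t⁵`
  have h1 := valuation_inv_u_pow_mul_eq hu0 hu2 1 x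
  rw [pow_one] at h1
  calc v x ^ 4 = (v (u⁻¹ ^ (2 * 1) * x) * t) ^ 4 := by rw [h1]
    _ = v (u⁻¹ ^ (2 * 1) * x) ^ 4 * t ^ 4 := mul_pow _ _ _
    _ = t * t ^ 4 := by rw [show (2 * 1 : ℕ) = 2 from rfl, h]
    _ = t ^ 5 := by rw [← pow_succ']

/-- **`III*`, CASE A′ (`v(b₂) = v(3)²`): every root of `ψ₃` has `v(ξ) = v(3)` or `v(ξ)³ = v(3)⁴`**.
[folklore] -/
theorem valuation_eq_or_pow_three_eq_of_isRoot_Ψ₃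
    (hb2 : (placeOver 3).valuation W.b₂ = (placeOver 3).valuation (3 : AlgebraicClosure ℚ) ^ 2)
    (hb4 : (placeOver 3).valuation W.b₄ = (placeOver 3).valuation (3 : AlgebraicClosure ℚ) ^ 3)
    (hb6 : (placeOver 3).valuation W.b₆ ≤ (placeOver 3).valuation (3 : AlgebraicClosure ℚ) ^ 5)
    (hb8 : (placeOver 3).valuation W.b₈ = (placeOver 3).valuation (3 : AlgebraicClosure ℚ) ^ 6)
    {x : AlgebraicClosure ℚ} (hx : W.Ψ₃.IsRoot x) :
    (placeOver 3).valuation x = (placeOver 3).valuation (3 : AlgebraicClosure ℚ) ∨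
      (placeOver 3).valuation x ^ 3 = (placeOver 3).valuation (3 : AlgebraicClosure ℚ) ^ 4 := by
  set v := (placeOver 3).valuation with hv
  set t := v (3 : AlgebraicClosure ℚ) with ht
  obtain ⟨u, hu2⟩ := IsAlgClosed.exists_pow_nat_eq (3 : AlgebraicClosure ℚ) (by norm_num : 0 < 2)
  have hu0 : u ≠ 0 := by rintro rfl; norm_num at hu2
  set W' := (VariableChange.mk (Units.mk0 u hu0) 0 0 0) • W with hW'
  have hb2' : v W'.b₂ = t := by
    rw [hW', b₂_variableChange_u]
    simpa using valuation_inv_u_pow_mul_eq_pow hu0 hu2 (k := 1) (m := 1) (by simpa using hb2)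
  have hb4' : v W'.b₄ = t := by
    rw [hW', b₄_variableChange_u]
    simpa using valuation_inv_u_pow_mul_eq_pow hu0 hu2 (k := 2) (m := 1) (by simpa using hb4)
  have hb6' : v W'.b₆ ≤ t ^ 2 := by
    rw [hW', b₆_variableChange_u]; exact valuation_inv_u_pow_mul_le hu0 hu2 (k := 3) (m := 2) hb6
  have hb8' : v W'.b₈ = t ^ 2 := by
    rw [hW', b₈_variableChange_u]; exact valuation_inv_u_pow_mul_eq_pow hu0 hu2 (k := 4) (m := 2) hb8
  have hx' : W'.Ψ₃.IsRoot (u⁻¹ ^ 2 * x) := by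
    rw [IsRoot.def, hW', eval_Ψ₃_variableChange_u, hx.eq_zero, mul_zero]
  have h1 := valuation_inv_u_pow_mul_eq hu0 hu2 1 x
  rw [pow_one, show (2 * 1 : ℕ) = 2 from rfl] at h1
  rcases valuation_eq_one_or_pow_three_eq_of_isRoot_Ψ₃' W' hb2' hb4' hb6' hb8' hx' with h | h
  · left
    calc v x = v (u⁻¹ ^ 2 * x) * t := h1.symm
      _ = t := by rw [h, one_mul]
  · right
    calc v x ^ 3 = (v (u⁻¹ ^ 2 * x) * t) ^ 3 := by rw [h1]
      _ = v (u⁻¹ ^ 2 * x) ^ 3 * t ^ 3 := mul_pow _ _ _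
      _ = t * t ^ 3 := by rw [h]
      _ = t ^ 4 := by rw [← pow_succ']

/-- **`III*`, CASE A′: some root of `ψ₃` has `v(ξ)³ = v(3)⁴`.** [folklore] -/
theorem exists_isRoot_Ψ₃_valuation_pow_three_eq
    (hb2 : (placeOver 3).valuation W.b₂ = (placeOver 3).valuation (3 : AlgebraicClosure ℚ) ^ 2)
    (hb4 : (placeOver 3).valuation W.b₄ = (placeOver 3).valuation (3 : AlgebraicClosure ℚ) ^ 3)
    (hb6 : (placeOver 3).valuation W.b₆ ≤ (placeOver 3).valuation (3 : AlgebraicClosure ℚ) ^ 5)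
    (hb8 : (placeOver 3).valuation W.b₈ = (placeOver 3).valuation (3 : AlgebraicClosure ℚ) ^ 6) :
    ∃ x : AlgebraicClosure ℚ, W.Ψ₃.IsRoot x ∧
      (placeOver 3).valuation x ^ 3 = (placeOver 3).valuation (3 : AlgebraicClosure ℚ) ^ 4 := by
  set v := (placeOver 3).valuation with hv
  set t := v (3 : AlgebraicClosure ℚ) with ht
  have h3 : (3 : AlgebraicClosure ℚ) ≠ 0 := by norm_num
  obtain ⟨u, hu2⟩ := IsAlgClosed.exists_pow_nat_eq (3 : AlgebraicClosure ℚ) (by norm_num : 0 < 2)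
  have hu0 : u ≠ 0 := by rintro rfl; norm_num at hu2
  set W' := (VariableChange.mk (Units.mk0 u hu0) 0 0 0) • W with hW'
  have hb2' : v W'.b₂ = t := by
    rw [hW', b₂_variableChange_u]
    simpa using valuation_inv_u_pow_mul_eq_pow hu0 hu2 (k := 1) (m := 1) (by simpa using hb2)
  have hb4' : v W'.b₄ = t := by
    rw [hW', b₄_variableChange_u]
    simpa using valuation_inv_u_pow_mul_eq_pow hu0 hu2 (k := 2) (m := 1) (by simpa using hb4)
  have hb6' : v W'.b₆ ≤ t ^ 2 := by
    rw [hW', b₆_variableChange_u]; exact valuation_inv_u_pow_mul_le hu0 hu2 (k := 3) (m := 2) hb6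
  have hb8' : v W'.b₈ = t ^ 2 := by
    rw [hW', b₈_variableChange_u]; exact valuation_inv_u_pow_mul_eq_pow hu0 hu2 (k := 4) (m := 2) hb8
  obtain ⟨x', hx', hvx'⟩ := exists_isRoot_Ψ₃_valuation_pow_three_eq' W' h3 hb2' hb4' hb6' hb8'
  -- pull the root back: `x = u² x'`
  refine ⟨u ^ 2 * x', ?_, ?_⟩
  · have e : u⁻¹ ^ 2 * (u ^ 2 * x') = x' := by
      rw [← mul_assoc, ← mul_pow, inv_mul_cancel₀ hu0, one_pow, one_mul]
    have h := eval_Ψ₃_variableChange_u W hu0 (u ^ 2 * x')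
    rw [e, ← hW', hx'.eq_zero] at h
    -- `0 = u⁻⁸ ψ₃(u² x')`
    have hu8 : u⁻¹ ^ 8 ≠ 0 := pow_ne_zero _ (inv_ne_zero hu0)
    exact (mul_eq_zero.mp h.symm).resolve_left hu8
  · have hvu : v u ^ 2 = t := by rw [← map_pow, hu2]
    calc v (u ^ 2 * x') ^ 3 = (t * v x') ^ 3 := by rw [map_mul, map_pow, hvu]
      _ = t ^ 3 * v x' ^ 3 := mul_pow _ _ _
      _ = t ^ 3 * t := by rw [hvx']
      _ = t ^ 4 := by rw [← pow_succ]

/-- **`III*`, S2: `v(x)⁹ = v(x') v(3)¹²` for the abscissa `x` of a point `Q` with `3Q = (x', y')` of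
order `3`** — from the multiplication-by-`3` relation `x'ψ₃(x)² = Φ₃(x)` with `v(3)⁴ ≤ v(x')³`,
`v(x') ≤ v(3)` (`v(b₂) ≤ v(3)²`, `v(b₄) ≤ v(3)³`, `v(b₆) ≤ v(3)⁵`, `v(b₈) = v(3)⁶`), via the
`III` statement for `⟨u,0,0,0⟩ • W`. [folklore] -/
theorem valuation_pow_nine_eq_of_mul_rel
    (hb2 : (placeOver 3).valuation W.b₂ ≤ (placeOver 3).valuation (3 : AlgebraicClosure ℚ) ^ 2)
    (hb4 : (placeOver 3).valuation W.b₄ ≤ (placeOver 3).valuation (3 : AlgebraicClosure ℚ) ^ 3)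
    (hb6 : (placeOver 3).valuation W.b₆ ≤ (placeOver 3).valuation (3 : AlgebraicClosure ℚ) ^ 5)
    (hb8 : (placeOver 3).valuation W.b₈ = (placeOver 3).valuation (3 : AlgebraicClosure ℚ) ^ 6)
    {x x' : AlgebraicClosure ℚ} (hrel : x' * (W.Ψ₃.eval x) ^ 2 = (W.Φ 3).eval x)
    (hx'1 : (placeOver 3).valuation x' ≤ (placeOver 3).valuation (3 : AlgebraicClosure ℚ))
    (hx'3 : (placeOver 3).valuation (3 : AlgebraicClosure ℚ) ^ 4 ≤ (placeOver 3).valuation x' ^ 3) :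
    (placeOver 3).valuation x ^ 9 =
      (placeOver 3).valuation x' * (placeOver 3).valuation (3 : AlgebraicClosure ℚ) ^ 12 := by
  set v := (placeOver 3).valuation with hv
  set t := v (3 : AlgebraicClosure ℚ) with ht
  have ht0 : t ≠ 0 := valuation_three_ne_zero
  obtain ⟨u, hu2⟩ := IsAlgClosed.exists_pow_nat_eq (3 : AlgebraicClosure ℚ) (by norm_num : 0 < 2)
  have hu0 : u ≠ 0 := by rintro rfl; norm_num at hu2
  set W' := (VariableChange.mk (Units.mk0 u hu0) 0 0 0) • W with hW'
  have hb2' : v W'.b₂ ≤ t := by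
    rw [hW', b₂_variableChange_u]
    simpa using valuation_inv_u_pow_mul_le hu0 hu2 (k := 1) (m := 1) (by simpa using hb2)
  have hb4' : v W'.b₄ ≤ t := by
    rw [hW', b₄_variableChange_u]
    simpa using valuation_inv_u_pow_mul_le hu0 hu2 (k := 2) (m := 1) (by simpa using hb4)
  have hb6' : v W'.b₆ ≤ t ^ 2 := by
    rw [hW', b₆_variableChange_u]; exact valuation_inv_u_pow_mul_le hu0 hu2 (k := 3) (m := 2) hb6
  have hb8' : v W'.b₈ = t ^ 2 := by
    rw [hW', b₈_variableChange_u]; exact valuation_inv_u_pow_mul_eq_pow hu0 hu2 (k := 4) (m := 2) hb8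
  -- the rescaled relation
  have hrel0 : (W.Φ 3).eval x - x' * (W.Ψ₃.eval x) ^ 2 = 0 := by rw [← hrel]; ring
  have hrel' : (u⁻¹ ^ 2 * x') * (W'.Ψ₃.eval (u⁻¹ ^ 2 * x)) ^ 2 = (W'.Φ 3).eval (u⁻¹ ^ 2 * x) := by
    have h := eval_Φ_three_sub_variableChange_u W hu0 x x'
    rw [hrel0, mul_zero, ← hW', sub_eq_zero] at h
    exact h.symm
  -- the rescaled abscissa `x'/u²` is a unit-or-less with `t ≤ v(x'/u²)³`
  have h1 := valuation_inv_u_pow_mul_eq hu0 hu2 1 x'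
  rw [pow_one, show (2 * 1 : ℕ) = 2 from rfl] at h1
  have hx1' : v (u⁻¹ ^ 2 * x') ≤ 1 := by
    have : v (u⁻¹ ^ 2 * x') * t ≤ 1 * t := by rw [h1, one_mul]; exact hx'1
    exact le_of_mul_le_mul_right this (zero_lt_iff.mpr ht0)
  have hx3' : t ≤ v (u⁻¹ ^ 2 * x') ^ 3 := by
    have : t * t ^ 3 ≤ v (u⁻¹ ^ 2 * x') ^ 3 * t ^ 3 := by
      rw [← pow_succ', ← mul_pow, h1]; exact hx'3
    exact le_of_mul_le_mul_right this (zero_lt_iff.mpr (pow_ne_zero _ ht0))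
  have h := GaloisImage.valuation_pow_nine_eq_of_mul_rel W' hb2' hb4' hb6' hb8' hrel' hx1' hx3'
  -- `v(u⁻²x)⁹ = v(u⁻²x') t⁴` ⟹ `v(x)⁹ = v(x') t¹²`
  have h2 := valuation_inv_u_pow_mul_eq hu0 hu2 1 x
  rw [pow_one, show (2 * 1 : ℕ) = 2 from rfl] at h2
  calc v x ^ 9 = (v (u⁻¹ ^ 2 * x) * t) ^ 9 := by rw [h2]
    _ = v (u⁻¹ ^ 2 * x) ^ 9 * t ^ 9 := mul_pow _ _ _
    _ = v (u⁻¹ ^ 2 * x') * t ^ 4 * t ^ 9 := by rw [h]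
    _ = v (u⁻¹ ^ 2 * x') * t * t ^ 12 := by
        rw [mul_assoc, mul_assoc, ← pow_add, show 4 + 9 = 1 + 12 from rfl, pow_add, pow_one]
    _ = v x' * t ^ 12 := by rw [h1]

end IIIstar

end Summit.BirchSwinnertonDyer.Rank1Residual.GaloisImage

end
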